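import Mathlib
import Literature.Combinatorics.Additive.TripleProductProperty

/-!
# Footprint expansion for S3 from a product-set structure dichotomy — the skeleton of THEOREM F′,
# composition kernel-checked
# (crux `LevelGradedCohnUmans.GradedDesignFamily`, stmt-MatrixMultiplication-7610; negative side,
# line `quadratic-extension-level-one-cell`, unit b2b-lgcu-subfield gen 18)

HONEST FRAMING.  This file PROVES NOTHING NEW ABOUT S3 by itself: it is the kernel-checked
COMPOSITION step of the paper refutation THEOREM F′ (write-up `THEOREM-F.md` of the unit), reducing
FOOTPRINT EXPANSION (the hypothesis of `not_subfieldCell_of_footprintExpansion`,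
`Negative/SubfieldCellFootprint.lean`) to four named inputs, each spelled INLINE as a hypothesis:

* (T) PRODUCT-SET STRUCTURE (a weakening of Tao 2008, Thm 4.6, rendered with Mathlib's
  `IsApproximateSubgroup`): if `|A·B| ≤ K·(|A||B|)^{1/2}` then `A ⊆ X·𝓗`, `B ⊆ 𝓗·X` for an
  `M(K)`-approximate subgroup `𝓗` with `|𝓗| ≤ M(K)(|A||B|)^{1/2}` and `|X| ≤ M(K)` — a LITERATURE input,
  to be supplied as a cited fact;
* (S) STRUCTURE DICHOTOMY: an `M`-approximate subgroup `𝓗 ⊆ GL₂(K)` with `c₁|K|³ ≤ |𝓗| ≤ c₂|K|³`,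
  `|K| ≥ Q₂(M,c₁,c₂)`, has at most `m₀(M,c₁,c₂)` determinant values or fixes a line of `K²` — on paper:
  Breuillard–Green–Tao 2011 Thm 1.3 in `SL₂(K)` + Dickson + determinant fibres (THEOREM-F.md §3 Step 3);
* (E1) SLICED ENDGAME: a TPP triple `(φ(SL₂ k), Y, Z)` with `|φ(SL₂ k)|, |Y|, |Z| ≥ c|K|^{3/2}` cannot
  have `≤ m` determinant values on `Y` and on `Z` once `|K| ≥ Q₃(c,m)` — on paper: the tree's
  `detSpread_card_mul_le` + `SL₂(k)` perfect;
* (E2) BOREL ENDGAME: `φ(SL₂ k)` is not contained in `X·Stab(ℓ)·g` with `|X| ≤ M` once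
  `|K| ≥ Q₄(M)` — on paper: line stabilisers in `φ(SL₂ k)` have order `≤ q(q−1)`.

`footprintExpansion_of_structure : (T) → (S) → (E1) → (E2) → FOOTPRINT EXPANSION` is proved here
(balanced factorisation `φ(SL₂ k)·Y·Y⁻¹·Z = (φ(SL₂ k)·Y)·(Y⁻¹·Z)`, both factors of size `≥ c²|K|³` by
the TPP: `subfieldCell_card_imageMulY`, `subfieldCell_card_invYMulZ`).  Each hypothesis is a separate,
precisely typed target for later work; none is proved here.  NOT summit progress (the whole programme
is the NEGATIVE decision of the design stub S3).

Sorry-free. [folklore]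
-/

set_option linter.dupNamespace false

noncomputable section

open scoped BigOperators Pointwise

namespace Summit.MatrixMultiplication.MatrixMultiplication.Theorems.GradedDesignFamily.Negative

/-- `|φ(SL₂ k)·Y| = |φ(SL₂ k)|·|Y|` for a TPP triple `(φ(SL₂ k), Y, Z)` with `Z ≠ ∅`. [folklore] -/
theorem subfieldCell_card_imageMulY {k K : Type} [Field k] [Fintype k] [DecidableEq k] [Field K]
    [Fintype K] [DecidableEq K]
    (φ : Matrix.SpecialLinearGroup (Fin 2) k →* Matrix.GeneralLinearGroup (Fin 2) K)
    (hφ : Function.Injective φ) (Y Z : Finset (Matrix.GeneralLinearGroup (Fin 2) K))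
    (hT : Literature.Combinatorics.Additive.TripleProductProperty (Finset.univ.image φ) Y Z)
    (hZ : Z.Nonempty) :
    (Finset.univ.image φ * Y).card = (Finset.univ.image φ).card * Y.card := by
  obtain ⟨z₀, hz₀⟩ := hZ
  rw [← Finset.image_mul_product, Finset.card_image_of_injOn, Finset.card_product]
  rintro ⟨h, y⟩ hmem ⟨h', y'⟩ hmem' heq
  simp only [Finset.coe_product, Set.mem_prod, Finset.mem_coe] at hmem hmem'
  obtain ⟨a, -, rfl⟩ := Finset.mem_image.1 hmem.1
  obtain ⟨a', -, rfl⟩ := Finset.mem_image.1 hmem'.1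
  have heq' : φ a * y = φ a' * y' := heq
  have hw : φ (a'⁻¹ * a) * (1 : Matrix.GeneralLinearGroup (Fin 2) K)⁻¹ * (y * y'⁻¹) * (z₀ * z₀⁻¹) = 1 := by
    rw [map_mul, map_inv, inv_one, mul_one, mul_inv_cancel, mul_one]
    calc (φ a')⁻¹ * φ a * (y * y'⁻¹) = (φ a')⁻¹ * (φ a * y) * y'⁻¹ := by group
      _ = 1 := by rw [heq']; group
  obtain ⟨h1, h2, -⟩ := hT (φ (a'⁻¹ * a)) (Finset.mem_image_of_mem φ (Finset.mem_univ _)) 1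
    (Finset.mem_image.2 ⟨1, Finset.mem_univ _, map_one φ⟩) y hmem.2 y' hmem'.2 z₀ hz₀ z₀ hz₀ hw
  have ha : a'⁻¹ * a = 1 := hφ (by rw [h1, map_one])
  have ha' : a = a' := by
    calc a = a' * (a'⁻¹ * a) := by group
      _ = a' := by rw [ha, mul_one]
  simp [ha', h2]

/-- `|Y⁻¹·Z| = |Y|·|Z|` for a TPP triple `(φ(SL₂ k), Y, Z)`. [folklore] -/
theorem subfieldCell_card_invYMulZ {k K : Type} [Field k] [Fintype k] [DecidableEq k] [Field K]
    [Fintype K] [DecidableEq K]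
    (φ : Matrix.SpecialLinearGroup (Fin 2) k →* Matrix.GeneralLinearGroup (Fin 2) K)
    (Y Z : Finset (Matrix.GeneralLinearGroup (Fin 2) K))
    (hT : Literature.Combinatorics.Additive.TripleProductProperty (Finset.univ.image φ) Y Z) :
    (Y⁻¹ * Z).card = Y.card * Z.card := by
  rw [← Finset.image_mul_product, Finset.card_image_of_injOn, Finset.card_product, Finset.card_inv]
  rintro ⟨w, z⟩ hmem ⟨w', z'⟩ hmem' heq
  simp only [Finset.coe_product, Set.mem_prod, Finset.mem_coe] at hmem hmem'
  obtain ⟨y, hy, rfl⟩ := Finset.mem_inv.1 hmem.1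
  obtain ⟨y', hy', rfl⟩ := Finset.mem_inv.1 hmem'.1
  have heq' : y⁻¹ * z = y'⁻¹ * z' := heq
  have h1 : (1 : Matrix.GeneralLinearGroup (Fin 2) K) ∈ Finset.univ.image φ :=
    Finset.mem_image.2 ⟨1, Finset.mem_univ _, map_one φ⟩
  have hw : (1 : Matrix.GeneralLinearGroup (Fin 2) K) * (1 : Matrix.GeneralLinearGroup (Fin 2) K)⁻¹ *
      (y' * y⁻¹) * (z * z'⁻¹) = 1 := by
    rw [inv_one, mul_one, one_mul]
    calc y' * y⁻¹ * (z * z'⁻¹) = y' * (y⁻¹ * z) * z'⁻¹ := by group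
      _ = 1 := by rw [heq']; group
  obtain ⟨-, h2, h3⟩ := hT 1 h1 1 h1 y' hy' y hy z hmem.2 z' hmem'.2 hw
  simp [h2, h3]

/-- **FOOTPRINT EXPANSION from the structure dichotomy** — the kernel-checked composition of THEOREM
F′: hypotheses (T) product-set structure (Tao 2008 Thm 4.6 type), (S) structure dichotomy for
approximate subgroups of `GL₂(K)` of size `≍ |K|³`, (E1) sliced endgame, (E2) Borel endgame — all
spelled inline and NOT proved here; conclusion = the hypothesis of
`not_subfieldCell_of_footprintExpansion`.  NOT summit progress.
[cite: Tao2006, Thm 4.6; BreuillardGreenTao2011, Thm 1.3] -/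
theorem footprintExpansion_of_structure
    (hT : ∃ M : ℝ → ℝ, ∀ K₀ : ℝ, 1 ≤ K₀ → 1 ≤ M K₀ ∧
      ∀ (G : Type) [Group G] [DecidableEq G] (A B : Finset G), A.Nonempty → B.Nonempty →
        ((A * B).card : ℝ) ≤ K₀ * Real.sqrt ((A.card : ℝ) * B.card) →
        ∃ H X : Finset G, IsApproximateSubgroup (M K₀) (H : Set G) ∧ (X.card : ℝ) ≤ M K₀ ∧
          (H.card : ℝ) ≤ M K₀ * Real.sqrt ((A.card : ℝ) * B.card) ∧ A ⊆ X * H ∧ B ⊆ H * X)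
    (hS : ∀ M c₁ c₂ : ℝ, 1 ≤ M → 0 < c₁ → 0 < c₂ → ∃ m₀ Q₂ : ℕ,
      ∀ (K : Type) [Field K] [Fintype K] [DecidableEq K], Q₂ ≤ Fintype.card K →
        ∀ A : Finset (Matrix.GeneralLinearGroup (Fin 2) K),
          IsApproximateSubgroup M (A : Set (Matrix.GeneralLinearGroup (Fin 2) K)) →
          c₁ * (Fintype.card K : ℝ) ^ 3 ≤ A.card → (A.card : ℝ) ≤ c₂ * (Fintype.card K : ℝ) ^ 3 →
          (A.image Matrix.GeneralLinearGroup.det).card ≤ m₀ ∨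
            ∃ v : Fin 2 → K, v ≠ 0 ∧ ∀ a ∈ A, ∃ t : K,
              (a : Matrix (Fin 2) (Fin 2) K).mulVec v = t • v)
    (hE1 : ∀ c : ℝ, 0 < c → ∀ m : ℕ, ∃ Q₃ : ℕ, ∀ (k K : Type) [Field k] [Fintype k] [DecidableEq k]
      [Field K] [Fintype K] [DecidableEq K]
      (φ : Matrix.SpecialLinearGroup (Fin 2) k →* Matrix.GeneralLinearGroup (Fin 2) K),
      Function.Injective φ → Fintype.card K = Fintype.card k ^ 2 → Q₃ ≤ Fintype.card K →
      ∀ Y Z : Finset (Matrix.GeneralLinearGroup (Fin 2) K),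
        c * (Fintype.card K : ℝ) ^ (3 / 2 : ℝ) ≤ (Finset.univ.image φ).card →
        c * (Fintype.card K : ℝ) ^ (3 / 2 : ℝ) ≤ Y.card →
        c * (Fintype.card K : ℝ) ^ (3 / 2 : ℝ) ≤ Z.card →
        Literature.Combinatorics.Additive.TripleProductProperty (Finset.univ.image φ) Y Z →
        (Y.image Matrix.GeneralLinearGroup.det).card ≤ m →
        (Z.image Matrix.GeneralLinearGroup.det).card ≤ m → False)
    (hE2 : ∀ M : ℕ, ∃ Q₄ : ℕ, ∀ (k K : Type) [Field k] [Fintype k] [DecidableEq k]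
      [Field K] [Fintype K] [DecidableEq K]
      (φ : Matrix.SpecialLinearGroup (Fin 2) k →* Matrix.GeneralLinearGroup (Fin 2) K),
      Function.Injective φ → Fintype.card K = Fintype.card k ^ 2 → Q₄ ≤ Fintype.card K →
      ∀ v : Fin 2 → K, v ≠ 0 → ∀ X : Finset (Matrix.GeneralLinearGroup (Fin 2) K), X.card ≤ M →
        ∀ g : Matrix.GeneralLinearGroup (Fin 2) K,
          (∀ a : Matrix.SpecialLinearGroup (Fin 2) k, ∃ x ∈ X, ∃ s : Matrix.GeneralLinearGroup (Fin 2) K,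
            (∃ t : K, (s : Matrix (Fin 2) (Fin 2) K).mulVec v = t • v) ∧ φ a = x * s * g) → False) :
    ∀ c C : ℝ, 0 < c → 0 < C → ∃ Q₁ : ℕ, ∀ (k K : Type) [Field k] [Fintype k] [DecidableEq k]
      [Field K] [Fintype K] [DecidableEq K]
      (φ : Matrix.SpecialLinearGroup (Fin 2) k →* Matrix.GeneralLinearGroup (Fin 2) K),
      Function.Injective φ → Fintype.card K = Fintype.card k ^ 2 → Q₁ ≤ Fintype.card K →
      ∀ Y Z : Finset (Matrix.GeneralLinearGroup (Fin 2) K),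
        c * (Fintype.card K : ℝ) ^ (3 / 2 : ℝ) ≤ (Finset.univ.image φ).card →
        c * (Fintype.card K : ℝ) ^ (3 / 2 : ℝ) ≤ Y.card →
        c * (Fintype.card K : ℝ) ^ (3 / 2 : ℝ) ≤ Z.card →
        Literature.Combinatorics.Additive.TripleProductProperty (Finset.univ.image φ) Y Z →
        C * (Fintype.card K : ℝ) ^ 3 < ((Finset.univ.image φ * Y * Y⁻¹ * Z).card : ℝ) := by
  intro c C hc hC
  -- constants
  obtain ⟨Mf, hMf⟩ := hT
  set K₀ : ℝ := max 1 (C / c ^ 2) with hK₀def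
  have hK₀1 : 1 ≤ K₀ := le_max_left _ _
  obtain ⟨hM1, hTao⟩ := hMf K₀ hK₀1
  set M : ℝ := Mf K₀ with hMdef
  have hM0 : 0 < M := by linarith
  obtain ⟨m₀, Q₂, hS'⟩ := hS M (c ^ 2 / M) (M * C) hM1 (by positivity) (by positivity)
  obtain ⟨Q₃, hE1'⟩ := hE1 c hc (⌊M⌋₊ * m₀)
  obtain ⟨Q₄, hE2'⟩ := hE2 ⌊M⌋₊
  refine ⟨max (max Q₂ Q₃) Q₄, ?_⟩
  intro k K _ _ _ _ _ _ φ hφ hK hQ Y Z hH hY hZ htpp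
  have hQ2 : Q₂ ≤ Fintype.card K := ((le_max_left _ _).trans (le_max_left _ _)).trans hQ
  have hQ3 : Q₃ ≤ Fintype.card K := ((le_max_right _ _).trans (le_max_left _ _)).trans hQ
  have hQ4 : Q₄ ≤ Fintype.card K := (le_max_right _ _).trans hQ
  by_contra hP
  rw [not_lt] at hP
  -- basic sizes
  have hQ1 : (1 : ℝ) ≤ (Fintype.card K : ℝ) := Nat.one_le_cast.2 Fintype.card_pos
  have hQ0 : (0 : ℝ) < (Fintype.card K : ℝ) := by linarith
  have hspos : (0 : ℝ) < (Fintype.card K : ℝ) ^ (3 / 2 : ℝ) := Real.rpow_pos_of_pos hQ0 _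
  have hs2 : ((Fintype.card K : ℝ) ^ (3 / 2 : ℝ)) ^ 2 = (Fintype.card K : ℝ) ^ 3 := by
    rw [sq, ← Real.rpow_add hQ0]
    norm_num
  have hYne : Y.Nonempty := by
    rw [← Finset.card_pos]
    have : (0 : ℝ) < Y.card := lt_of_lt_of_le (mul_pos hc hspos) hY
    exact_mod_cast this
  have hZne : Z.Nonempty := by
    rw [← Finset.card_pos]
    have : (0 : ℝ) < Z.card := lt_of_lt_of_le (mul_pos hc hspos) hZ
    exact_mod_cast this
  have h1H : (1 : Matrix.GeneralLinearGroup (Fin 2) K) ∈ Finset.univ.image φ :=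
    Finset.mem_image.2 ⟨1, Finset.mem_univ _, map_one φ⟩
  have hAne : (Finset.univ.image φ * Y).Nonempty := Finset.Nonempty.mul ⟨1, h1H⟩ hYne
  have hBne : (Y⁻¹ * Z).Nonempty := Finset.Nonempty.mul hYne.inv hZne
  -- the balanced factorisation: both factors have size `≥ c² Q³`
  have hAcard : ((Finset.univ.image φ * Y).card : ℝ) = ((Finset.univ.image φ).card : ℝ) * Y.card := by
    exact_mod_cast subfieldCell_card_imageMulY φ hφ Y Z htpp hZne
  have hBcard : ((Y⁻¹ * Z).card : ℝ) = (Y.card : ℝ) * Z.card := by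
    exact_mod_cast subfieldCell_card_invYMulZ φ Y Z htpp
  have hprod : ∀ a b : ℝ, c * (Fintype.card K : ℝ) ^ (3 / 2 : ℝ) ≤ a →
      c * (Fintype.card K : ℝ) ^ (3 / 2 : ℝ) ≤ b → c ^ 2 * (Fintype.card K : ℝ) ^ 3 ≤ a * b := by
    intro a b ha hb
    have h := mul_le_mul ha hb (by positivity) ((mul_pos hc hspos).le.trans ha)
    calc c ^ 2 * (Fintype.card K : ℝ) ^ 3
        = c * (Fintype.card K : ℝ) ^ (3 / 2 : ℝ) * (c * (Fintype.card K : ℝ) ^ (3 / 2 : ℝ)) := by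
          rw [← hs2]; ring
      _ ≤ a * b := h
  have hAlo : c ^ 2 * (Fintype.card K : ℝ) ^ 3 ≤ (Finset.univ.image φ * Y).card := by
    rw [hAcard]; exact hprod _ _ hH hY
  have hBlo : c ^ 2 * (Fintype.card K : ℝ) ^ 3 ≤ (Y⁻¹ * Z).card := by
    rw [hBcard]; exact hprod _ _ hY hZ
  have hAB : Finset.univ.image φ * Y * (Y⁻¹ * Z) = Finset.univ.image φ * Y * Y⁻¹ * Z :=
    (mul_assoc _ _ _).symm
  have hABcard : ((Finset.univ.image φ * Y * (Y⁻¹ * Z)).card : ℝ) ≤ C * (Fintype.card K : ℝ) ^ 3 := by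
    rw [hAB]; exact hP
  have hc2Q : (0 : ℝ) ≤ c ^ 2 * (Fintype.card K : ℝ) ^ 3 := by positivity
  have hsqrt_lo : c ^ 2 * (Fintype.card K : ℝ) ^ 3 ≤
      Real.sqrt (((Finset.univ.image φ * Y).card : ℝ) * (Y⁻¹ * Z).card) := by
    apply Real.le_sqrt_of_sq_le
    rw [sq]
    exact mul_le_mul hAlo hBlo hc2Q (Nat.cast_nonneg _)
  have hA_le : ((Finset.univ.image φ * Y).card : ℝ) ≤ C * (Fintype.card K : ℝ) ^ 3 :=
    le_trans (by exact_mod_cast Finset.card_le_card_mul_right hBne) hABcard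
  have hB_le : ((Y⁻¹ * Z).card : ℝ) ≤ C * (Fintype.card K : ℝ) ^ 3 :=
    le_trans (by exact_mod_cast Finset.card_le_card_mul_left hAne) hABcard
  have hsqrt_hi : Real.sqrt (((Finset.univ.image φ * Y).card : ℝ) * (Y⁻¹ * Z).card) ≤
      C * (Fintype.card K : ℝ) ^ 3 := by
    calc Real.sqrt (((Finset.univ.image φ * Y).card : ℝ) * (Y⁻¹ * Z).card)
        ≤ Real.sqrt ((C * (Fintype.card K : ℝ) ^ 3) ^ 2) := by
          apply Real.sqrt_le_sqrt
          rw [sq]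
          exact mul_le_mul hA_le hB_le (Nat.cast_nonneg _) (by positivity)
      _ = C * (Fintype.card K : ℝ) ^ 3 := Real.sqrt_sq (by positivity)
  -- small doubling: `|A·B| ≤ K₀ (|A||B|)^{1/2}`
  have hdoub : ((Finset.univ.image φ * Y * (Y⁻¹ * Z)).card : ℝ) ≤
      K₀ * Real.sqrt (((Finset.univ.image φ * Y).card : ℝ) * (Y⁻¹ * Z).card) := by
    calc ((Finset.univ.image φ * Y * (Y⁻¹ * Z)).card : ℝ) ≤ C * (Fintype.card K : ℝ) ^ 3 := hABcard
      _ = C / c ^ 2 * (c ^ 2 * (Fintype.card K : ℝ) ^ 3) := by field_simp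
      _ ≤ K₀ * Real.sqrt (((Finset.univ.image φ * Y).card : ℝ) * (Y⁻¹ * Z).card) :=
          mul_le_mul (le_max_right _ _) hsqrt_lo hc2Q (by positivity)
  -- (T): the approximate group
  obtain ⟨𝓗, X, happ, hX, h𝓗hi, hAsub, hBsub⟩ :=
    hTao (Matrix.GeneralLinearGroup (Fin 2) K) (Finset.univ.image φ * Y) (Y⁻¹ * Z) hAne hBne hdoub
  have h𝓗lo : c ^ 2 / M * (Fintype.card K : ℝ) ^ 3 ≤ 𝓗.card := by
    have h1 : ((Finset.univ.image φ * Y).card : ℝ) ≤ (X * 𝓗).card := by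
      exact_mod_cast Finset.card_le_card hAsub
    have h2 : ((X * 𝓗).card : ℝ) ≤ (X.card : ℝ) * 𝓗.card := by exact_mod_cast Finset.card_mul_le
    have h3 : (X.card : ℝ) * 𝓗.card ≤ M * 𝓗.card := mul_le_mul_of_nonneg_right hX (Nat.cast_nonneg _)
    rw [div_mul_eq_mul_div, div_le_iff₀ hM0]
    linarith
  have h𝓗hi' : (𝓗.card : ℝ) ≤ M * C * (Fintype.card K : ℝ) ^ 3 := by
    calc (𝓗.card : ℝ) ≤ M * Real.sqrt (((Finset.univ.image φ * Y).card : ℝ) * (Y⁻¹ * Z).card) := h𝓗hi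
      _ ≤ M * (C * (Fintype.card K : ℝ) ^ 3) := mul_le_mul_of_nonneg_left hsqrt_hi hM0.le
      _ = M * C * (Fintype.card K : ℝ) ^ 3 := by ring
  have hXn : X.card ≤ ⌊M⌋₊ := Nat.le_floor hX
  obtain ⟨y₁, hy₁⟩ := hYne
  -- (S): the dichotomy
  rcases hS' K hQ2 𝓗 happ h𝓗lo h𝓗hi' with hdet | ⟨v, hv, hline⟩
  · -- SLICED: few determinant values on `Y` and on `Z`, then (E1)
    have hYdet : (Y.image Matrix.GeneralLinearGroup.det).card ≤ ⌊M⌋₊ * m₀ := by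
      have hsub : Y.image Matrix.GeneralLinearGroup.det ⊆
          X.image Matrix.GeneralLinearGroup.det * 𝓗.image Matrix.GeneralLinearGroup.det := by
        rw [← Finset.image_mul]
        exact Finset.image_subset_image
          ((Finset.subset_mul_right Y h1H).trans hAsub)
      calc (Y.image Matrix.GeneralLinearGroup.det).card
          ≤ (X.image Matrix.GeneralLinearGroup.det * 𝓗.image Matrix.GeneralLinearGroup.det).card :=
            Finset.card_le_card hsub
        _ ≤ (X.image Matrix.GeneralLinearGroup.det).card *
              (𝓗.image Matrix.GeneralLinearGroup.det).card := Finset.card_mul_le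
        _ ≤ ⌊M⌋₊ * m₀ := Nat.mul_le_mul (Finset.card_image_le.trans hXn) hdet
    have hZdet : (Z.image Matrix.GeneralLinearGroup.det).card ≤ ⌊M⌋₊ * m₀ := by
      have hsub : Z.image Matrix.GeneralLinearGroup.det ⊆
          Matrix.GeneralLinearGroup.det y₁ •
            (𝓗.image Matrix.GeneralLinearGroup.det * X.image Matrix.GeneralLinearGroup.det) := by
        intro d hd
        obtain ⟨z, hz, rfl⟩ := Finset.mem_image.1 hd
        have hmem : y₁⁻¹ * z ∈ 𝓗 * X := hBsub (Finset.mul_mem_mul (Finset.inv_mem_inv hy₁) hz)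
        rw [← Finset.image_mul]
        refine Finset.mem_smul_finset.2 ⟨Matrix.GeneralLinearGroup.det (y₁⁻¹ * z),
          Finset.mem_image_of_mem _ hmem, ?_⟩
        rw [smul_eq_mul, ← map_mul, mul_inv_cancel_left]
      calc (Z.image Matrix.GeneralLinearGroup.det).card
          ≤ (Matrix.GeneralLinearGroup.det y₁ •
              (𝓗.image Matrix.GeneralLinearGroup.det * X.image Matrix.GeneralLinearGroup.det)).card :=
            Finset.card_le_card hsub
        _ = (𝓗.image Matrix.GeneralLinearGroup.det * X.image Matrix.GeneralLinearGroup.det).card :=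
            Finset.card_smul_finset _ _
        _ ≤ (𝓗.image Matrix.GeneralLinearGroup.det).card *
              (X.image Matrix.GeneralLinearGroup.det).card := Finset.card_mul_le
        _ ≤ m₀ * ⌊M⌋₊ := Nat.mul_le_mul hdet (Finset.card_image_le.trans hXn)
        _ = ⌊M⌋₊ * m₀ := Nat.mul_comm _ _
    exact hE1' k K φ hφ hK hQ3 Y Z hH hY hZ htpp hYdet hZdet
  · -- BOREL: `φ(SL₂ k) ⊆ X · Stab(v) · y₁⁻¹`, then (E2)
    refine hE2' k K φ hφ hK hQ4 v hv X hXn y₁⁻¹ (fun a => ?_)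
    have hmem : φ a * y₁ ∈ X * 𝓗 :=
      hAsub (Finset.mul_mem_mul (Finset.mem_image_of_mem φ (Finset.mem_univ a)) hy₁)
    obtain ⟨x, hx, η, hη, hxη⟩ := Finset.mem_mul.1 hmem
    exact ⟨x, hx, η, hline η hη, eq_mul_inv_of_mul_eq hxη.symm⟩

end Summit.MatrixMultiplication.MatrixMultiplication.Theorems.GradedDesignFamily.Negative

end
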